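import Literature.Computability.Complexity.MurrayWilliams2018Protocol
import Literature.Computability.Complexity.MurrayWilliams2018HeadlineFromThm31
import Literature.Computability.Complexity.MurrayWilliams2018ExpLevelAllDepths
import Literature.Computability.Complexity.Williams2014Proofs
import HarnessLib

/-!
# Murray–Williams 2018, Theorem 1.3 (`MurrayWilliams2018_NTIME_not_depth_ACC`) split at its two
# remaining inputs: Santhanam's complete language (Thm. 2.2) and the exponential-level simulation (§5)

Literature / circuit complexity. SPLIT RECORD (fact-decompose, 2026-08-16) of the named fact
`Literature.Computability.Complexity.MurrayWilliams2018_NTIME_not_depth_ACC` (`CircuitLowerBounds.lean`;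
C. D. Murray, R. R. Williams, *Circuit lower bounds for nondeterministic quasi-polytime: an easy
witness lemma for NP and NQP*, STOC 2018 = SIAM J. Comput. 49 (2020), Thm. 1.3, bottom threshold
layer dropped). The tree has taken the printed proof apart completely and PROVED all of it but two
statements, which it keeps as inline hypotheses (D-0026):

* Thm. 1.3 ⇐ Thm. 1.2 (for `AC⁰[m]`) + Thm. 5.1 (`MurrayWilliams2018_NTIME_not_depth_ACC_of_components`,
  `MurrayWilliams2018.lean`), Thm. 5.1 = Williams' `ACC`-SAT algorithm DISCHARGED
  (`MurrayWilliams2018_thm_5_1_holds`, `Williams2014Proofs.lean`);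
* Thm. 1.2 ⇐ Lemma 4.1 in polylogarithmic-seed form + the exponential-level simulation `hN'`
  (`MurrayWilliams2018_thm_1_2_acc_of_lemma_4_1_qp_of_expSimulationAllDepths`,
  `MurrayWilliams2018ExpLevelAllDepths.lean`: the easy witness lemma for `NQP`, Lemma 1.3, the proved
  nondeterministic time hierarchy, padding);
* Lemma 4.1 ⇐ Thm. 3.1 in universal-referee form ALONE
  (`MurrayWilliams2018_lemma_4_1_qp_of_thm_3_1_universal`, `MurrayWilliams2018SimulationProofsQ.lean`:
  the derandomised advice simulation run with the PROVED generator of IKW Thm. 11 in place of Umans');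
* Thm. 3.1 ⇐ the existence of a `PSPACE`-hard, paddable, downward self-reducible, same-length
  checkable language (Thm. 2.2: Santhanam 2007/2009 after Trevisan–Vadhan) — its hardness half being
  a theorem (`AlmostAE`, scaled Kannan) and its Merlin–Arthur protocol being CONSTRUCTED and verified
  (`MWProtocol.h31_of_sameLengthChecker`, `MurrayWilliams2018Protocol.lean`).

This file vendors the two remaining inputs as named facts — `MurrayWilliams2018_thm_2_2` (Thm. 2.2,
in the tree's vocabulary `IsHard PSPACE`, the `1`-padding convention, `AlmostAE.DSR`,
`AlmostAE.SameLengthChecker`) and `MurrayWilliams2018_expSimulationAllDepths` (the §5 simulation at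
the exponential level calling the `AC⁰[m]`-SAT algorithms of every depth; verbatim `hN'`) — and
PROVES the assembly `MurrayWilliams2018_NTIME_not_depth_ACC_holds_of : thm_2_2 → expSimulationAllDepths
→ MurrayWilliams2018_NTIME_not_depth_ACC` by composing the four theorems above. Neither child
restates the parent: the first is a statement about `PSPACE`, the second a simulation lemma at the
exponential level (`NTIME(2ⁿ)` with subexponential witness circuits).

## On the first child (faithfulness)

Printed (MW Thm. 2.2, ECCC p. 9; Santhanam, SIAM J. Comput. 39 (2009), Lemma 11 after
Trevisan–Vadhan, Comput. Complexity 16 (2007), proof of Thm. 4.2): "There is a `PSPACE`-complete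
language `L_PSPACE` that is paddable, downward self-reducible, and same-length checkable." Only
hardness is consumed (`IsHard PSPACE`, Karp reductions). Paddability is rendered by the tree's
convention `1·z ∈ L ↔ z ∈ L` together with `1ᵇ ∉ L` (all-ones strings excluded): any language `L₀`
with the three printed properties yields `L = {1ᵃ 0 x | x ∈ L₀}` with these two clauses, `PSPACE`-hard
by `x ↦ 0x`, and downward self-reducible / same-length checkable with the reductions of `L₀` run on
the suffix after the first `0` (queries `1ᵃ 0 y` of the required length) — so the child is implied
by the printed theorem. `AlmostAE.DSR` (`MurrayWilliams2018DSR.lean`) and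
`AlmostAE.SameLengthChecker` (`MurrayWilliams2018Protocol.lean`, "The checkability clause over the
tree") are the tree's renderings of the two oracle notions, each asking no more than the source.

## References

* C. D. Murray, R. R. Williams, STOC 2018, 890–901 (ECCC TR17-188; SIAM J. Comput. 49 (2020)),
  Thm. 1.2, Thm. 1.3, Thm. 2.2, Thm. 3.1, Lemma 4.1, §5, Thm. 5.1. [MurrayWilliams2018]
* R. Santhanam, *Circuit lower bounds for Merlin–Arthur classes*, SIAM J. Comput. 39 (2009)
  1038–1061 (STOC 2007), Lemma 11. [Santhanam2009]
* L. Trevisan, S. Vadhan, *Pseudorandomness and average-case complexity via uniform reductions*,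
  Comput. Complexity 16 (2007), Thm. 4.2 / §4. [TrevisanVadhan2007]
* R. Williams, *Nonuniform ACC circuit lower bounds*, J. ACM 61 (2014), proof of Thm. 3.2, Thm. 4.1.
  [Williams2014]
-/

noncomputable section

namespace Literature.Computability.Complexity

open Filter

/-- **Murray–Williams 2018, Thm. 2.2 (Santhanam 2007 / Trevisan–Vadhan 2002): a `PSPACE`-hard
language that is paddable, downward self-reducible and same-length checkable**, in the tree's
vocabulary (see the module docstring for the padding convention): there is `L⋆ ⊆ {0,1}*` with
(i) every `PSPACE` language Karp-reduces to `L⋆` (`IsHard PSPACE`); (ii) `1·z ∈ L⋆ ↔ z ∈ L⋆` and no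
all-ones string lies in `L⋆` (paddability by leading `1`s); (iii) a polynomial-time downward
self-reduction deciding the slice of length `ℓ + 1` from any correct description of the slice of
length `ℓ` (`AlmostAE.DSR`); (iv) a probabilistic polynomial-time same-length checker with perfect
completeness against every correct same-length oracle and soundness `1/3` against every oracle
(`AlmostAE.SameLengthChecker`). Printed: "There is a `PSPACE`-complete language `L_PSPACE` that is
paddable, downward self-reducible, and same-length checkable" (the `PSPACE`-complete language of
Trevisan–Vadhan, an arithmetised TQBF, with Santhanam's same-length checker). NOT proved in the
tree (needs the TV/Santhanam construction: interactive proofs for `PSPACE` run as a checker).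
[cite: MurrayWilliams2018, Thm. 2.2] [cite: Santhanam2009, Lemma 11] [cite: TrevisanVadhan2007, Thm. 4.2] -/
def MurrayWilliams2018_thm_2_2 : Prop :=
  ∃ Lstar : Language Bool, IsHard PSPACE Lstar ∧
    (∀ z : List Bool, true :: z ∈ Lstar ↔ z ∈ Lstar) ∧ (∀ b : ℕ, List.replicate b true ∉ Lstar) ∧
    Nonempty (AlmostAE.DSR Lstar) ∧ Nonempty (AlmostAE.SameLengthChecker Lstar)

/-- **Murray–Williams 2018, §5 (proof of Thms. 1.1–1.2) at the exponential level: the simulation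
lemma, calling `AC⁰[m]`-SAT algorithms of every depth** (Williams, J. ACM 2014, proof of Thm. 3.2 —
the generator `A` of Lemma 3.1 and the machine `B` — re-run with QUASI-POLYNOMIAL-size circuits for
`P` and SUBEXPONENTIAL witness circuits, as the proof of MW Thm. 1.2 runs it, §5 pp. 14–15: "guesses
a witness circuit `W` of size `2^{O(log^{k³} n)}` … the assumed nondeterministic GAP `C` UNSAT
algorithm can be run on `D`"). Statement (verbatim the hypothesis `hN'` of
`MurrayWilliams2018_thm_1_2_acc_of_lemma_4_1_qp_of_expSimulationAllDepths`): for all `d`, `m ≥ 2`,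
`k ≥ 1`, if for every depth `d'` there is an `AC⁰[m]`-SAT algorithm for `2^{⌊w^{1/r}⌋}`-size depth-`d'`
circuits running in time `O(2^{w - ⌊w^{1/r}⌋})` for some `r ≥ 2` (`AccSatSubexp d' m r`), and if `P`
has depth-`d` `AC⁰[m]` circuit families of size `a · 2^{(log₂ n)^k} + a` (assumption (A) of the
printed proof), then for some `q ≥ 1` every `L ∈ NTIME(2ⁿ)` whose `2^{n³}`-time verifier has witness
circuits of size `2^{⌊n^{1/q}⌋}` lies in `NTIME(williamsBound)` (`= O(n + 2ⁿ/n)`), contradicting the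
nondeterministic time hierarchy downstream. The first half (the generator `A` at quasi-polynomial
size) is PROVED in `MurrayWilliams2018GeneratorQ.lean`; the machine `B` at this level is what
remains. [cite: MurrayWilliams2018, §5 (proof of Thm. 1.2, pp. 14–15)] [cite: Williams2014, proof of Thm. 3.2 (pp. 12–13) and Lemma 3.1] -/
def MurrayWilliams2018_expSimulationAllDepths : Prop :=
  ∀ (d m k : ℕ), 2 ≤ m → 1 ≤ k → (∀ d' : ℕ, ∃ r : ℕ, 2 ≤ r ∧ AccSatSubexp d' m r) →
    (Classes.P ⊆ ⋃ a : ℕ,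
        DepthSizeClass (accBasis m) (fun _ => d) (fun n => a * 2 ^ Nat.log 2 n ^ k + a)) →
    ∃ q : ℕ, 1 ≤ q ∧ ∀ L ∈ NTIME (fun n => 2 ^ n),
      HasWitnessCircuits (fun n => 2 ^ (n ^ 3)) L (fun n => 2 ^ Nat.nthRoot q n) →
      L ∈ NTIME williamsBound

/-- **Assembly of the split: Murray–Williams' Theorem 1.3 from Thm. 2.2 and the exponential-level
simulation.** Thm. 2.2 gives Thm. 3.1 in universal-referee form by the CONSTRUCTED Merlin–Arthur
protocol (`MWProtocol.h31_of_sameLengthChecker`); Thm. 3.1 gives Lemma 4.1 in polylogarithmic-seed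
form with the proved IKW generator (`MurrayWilliams2018_lemma_4_1_qp_of_thm_3_1_universal`); Lemma
4.1 and the simulation give Thm. 1.2 for `AC⁰[m]`
(`MurrayWilliams2018_thm_1_2_acc_of_lemma_4_1_qp_of_expSimulationAllDepths`); Thm. 1.2 and the
discharged Thm. 5.1 (`MurrayWilliams2018_thm_5_1_holds`) give Thm. 1.3
(`MurrayWilliams2018_NTIME_not_depth_ACC_of_components`).
[cite: MurrayWilliams2018, Thm. 1.3 (proof: §§3–5 with Thms. 1.2, 2.2, 3.1, Lemma 4.1, Thm. 5.1)] -/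
theorem MurrayWilliams2018_NTIME_not_depth_ACC_holds_of (h22 : MurrayWilliams2018_thm_2_2)
    (hN : MurrayWilliams2018_expSimulationAllDepths) : MurrayWilliams2018_NTIME_not_depth_ACC := by
  obtain ⟨Lstar, hhard, hpad, hones, ⟨R⟩, ⟨chk⟩⟩ := h22
  exact MurrayWilliams2018_NTIME_not_depth_ACC_of_components
    (MurrayWilliams2018_thm_1_2_acc_of_lemma_4_1_qp_of_expSimulationAllDepths
      (MurrayWilliams2018_lemma_4_1_qp_of_thm_3_1_universal
        (MWProtocol.h31_of_sameLengthChecker Lstar hhard hpad hones R chk)) hN)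
    MurrayWilliams2018_thm_5_1_holds

/-- The same composition one step earlier: **Thm. 1.2 for `AC⁰[m]` (`MurrayWilliams2018_thm_1_2_acc`,
the fact the capped seats were blocked on) from the two children.**
[cite: MurrayWilliams2018, Thm. 1.2 (proof: §§3–5)] -/
theorem MurrayWilliams2018_thm_1_2_acc_holds_of (h22 : MurrayWilliams2018_thm_2_2)
    (hN : MurrayWilliams2018_expSimulationAllDepths) : MurrayWilliams2018_thm_1_2_acc := by
  obtain ⟨Lstar, hhard, hpad, hones, ⟨R⟩, ⟨chk⟩⟩ := h22
  exact MurrayWilliams2018_thm_1_2_acc_of_lemma_4_1_qp_of_expSimulationAllDepths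
    (MurrayWilliams2018_lemma_4_1_qp_of_thm_3_1_universal
      (MWProtocol.h31_of_sameLengthChecker Lstar hhard hpad hones R chk)) hN

/-- … and **the headline `NQP ⊄ ACC⁰` (`MurrayWilliams2018_NQP_not_subset_ACC0`) from the FIRST child
alone** (the machine `B` at subexponential witness size being proved for the headline,
`MurrayWilliams2018_NQP_not_subset_ACC0_of_thm_3_1_universal`). [cite: MurrayWilliams2018, §1.1 and Thm. 1.3] -/
theorem MurrayWilliams2018_NQP_not_subset_ACC0_holds_of (h22 : MurrayWilliams2018_thm_2_2) :
    MurrayWilliams2018_NQP_not_subset_ACC0 := by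
  obtain ⟨Lstar, hhard, hpad, hones, ⟨R⟩, ⟨chk⟩⟩ := h22
  exact MurrayWilliams2018_NQP_not_subset_ACC0_of_thm_3_1_universal
    (MWProtocol.h31_of_sameLengthChecker Lstar hhard hpad hones R chk)

end Literature.Computability.Complexity

end
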